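import Literature.MathematicalPhysics.QuantumFieldTheory.Balaban1983to89.B5Eq129FreeResolventGradientRow
import Literature.MathematicalPhysics.QuantumFieldTheory.Balaban1983to89.B5Eq129FreeResolventGradientRowSites
import Literature.MathematicalPhysics.QuantumFieldTheory.Balaban1983to89.B9Eq331PureGaugeResolventLetters
import Literature.MathematicalPhysics.QuantumFieldTheory.Balaban1983to89.B9Eq342GradientRowBootstrap
import Literature.MathematicalPhysics.QuantumFieldTheory.Balaban1983to89.B9Eq342GradientRowComparisonMass

/-!
# `Balaban1983to89.B9Eq342GradientRowPureGaugeUnweighted` — T. Bałaban, *Propagators for lattice gauge theories in a background field*, Commun. Math. Phys. **99**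
# (1985) 389–434 [Balaban1985BackgroundPropagators] Thm 3.1 (3.42) p. 397 (the covariant-gradient row), p. 398 (gauge invariance), (3.23) p. 394; [Balaban1984PropagatorsI]
# (1.29) p. 23: **THE UNWEIGHTED COVARIANT GRADIENT ROW OF THE PURE-GAUGE RESOLVENT AND THE WINDOW-FREE CLOSING OF STOREY J's BOOTSTRAP AT THE COMPARISON
# BACKGROUND — `‖(∇_{U⁰}u)(b)‖ ≤ |t|·(2∕√(m² + 4mt²))·sup‖h‖` for every solution of `Δ_{U⁰}u + m u = h` (`U⁰ = 1^g`, any `t > 0`, any `m > 0`, any volume);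
# the response map `T b h := (∇_{U⁰}((Δ_{U⁰} + m)⁻¹h))(b)` inhabits `B9Eq342GradientRowBootstrap.norm_le_of_gradient_response_bootstrap`'s `hT` with `w ≡ 1`,
# `S = |t|·2∕√(m² + 4mt²) ≤ m^{−1∕2}`; and with `2ε₁ ≤ √m` (the comparison mass chosen after the background letter `ε₁`) the bootstrap closes with NO θ
# hypothesis: `‖D b‖ ≤ 2(Γ + ε₂N)∕√m + 2ε₀N`** — the tree form of the lineage's certificate J-STOREYJ-3 (t4-ne9-idea-1 g143 N44 §5's predicted junction)

statement-level skeleton of published theorems with citation tags; proofs where landed; nothing here is a claim about the Yang–Mills mass gap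

CITATION HEADER (lean-in-tree rule).  Audit cell `pub-balaban`, sub-cell `t4`, BINDER row NE9; filed by NE9 crux-team LEAF PROVER 05
(`b2b-balaban-t4-ne9-formalise-leaf-05`, gen 83).  SOURCE READ first-hand in the held text layer [Balaban1985BackgroundPropagators]
(`paper:balaban1985-cmp99-background-propagators`, journal page = PDF page + 388): p. 397 Thm 3.1 (3.42), p. 398, p. 394 (3.23); [Balaban1984PropagatorsI] p. 23 (1.29).
[folklore] COMPOSITION BY NAME of tree lemmas: (C) `B5Eq129FreeResolventGradientRow.norm_apply_sub_le_of_resolvent` (flat row, solution shape, `Tor N`), (K27)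
`B5Eq129FreeResolventGradientRowSites.gradRow_tsite_of_tor_shift` at weight parameter `a = 0`, (K29) `B9Eq331PureGaugeResolventConjugation.norm_covDeriv_pureGauge_le_of_flat`,
(K33) `B9Eq331PureGaugeResolventLetters` (`greenK` resolvent), (GRB) `B9Eq342GradientRowBootstrap` §4, (K35) `B9Eq342GradientRowComparisonMass` (t4-ne9-idea-1 g143's
θ-slot arithmetic).  The closing mechanism («the comparison mass is free») is t4-ne9-idea-1's N17 ∕ N22 ∕ P-J-3 ∕ N44 — credit theirs.  Nothing printed is a hypothesis
except `hAd`.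

WHAT IS PROVED (sorry-free; 0 `def`; one `local notation` `R⁰` for `greenK (Δ_{U⁰} + m·1) hpos` — syntactic; [folklore]).  `φ : W ≃ₗ[ℂ] 𝔸`, `g` with `hAd`, `U⁰ := gaugeU g 1`.
* §1 **`norm_covDeriv_pureGauge_le_unweighted`** — `t > 0`, `m > 0`: `Δ_{U⁰}u + m u = h`, `‖h(y)‖ ≤ F` ⊢ `‖(∇_{U⁰}u)(b)‖ ≤ ‖(t:ℂ)‖·((2∕√(m² + 4mt²))·F)`.
* §2 (`W` finite-dimensional) **`hT_unweighted`** — (GRB)'s `hT` binder for `T b h := (∇_{U⁰}(R⁰h̃))(b)` with `w ≡ 1`, `w′ ≡ 1`, `S := |t|·2∕√(m² + 4mt²)`.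
* §3 **`closing_unweighted`** — `0 ≤ ε₁, ε₂, Γ, N, ε₀N`, `2ε₁ ≤ √m`; (REP) `‖D b‖ ≤ ‖T b (g_b − V_b)‖ + ε₀N`, (DATA) `‖g_b(y)‖ ≤ Γ`, (PERT)
  `(∀ b, ‖D b‖ ≤ M) → ‖V_b(y)‖ ≤ ε₁M + ε₂N` ⊢ `‖D b‖ ≤ 2(Γ + ε₂N)∕√m + 2(ε₀N)`.
* §4 **`closing_unweighted_family`** — §3 for a BOND-DEPENDENT FAMILY `g_{b₀}` of comparison gauges (`T b₀` on `U⁰_{b₀} = 1^{g_{b₀}}`; §2 is uniform in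
  the gauge): the shape the (REP) instance needs, `U` being matched to a pure gauge per cube of (3.35).
HONEST SCOPE.  The UNWEIGHTED currency only: NE9's row needs the decay weights ((K∇) weighted letters; the weighted junction is `B9Eq342GradientRowPureGauge`
with its θ binder displayed) — the desk's (d1) stands for the row of record; (REP)∕(DATA)∕(PERT) displayed, not instantiated (OWNER's vocabulary); nothing of [B9] Thm
3.1 asserted, valued or discharged.  NOT summit progress (cell pub-balaban: NE9 NOT PRINTED ∕ NOT PROVED; «NE9 ⇐ the named binders»; row WALLED ON A MODEL (O-NE9-1; #5
UNRULED); spine PROVED 0∕9; rung (B)+1 finite T⁴ — NOT infinite volume, NOT mass gap, NOT BetaPertH, NOT Clay).  HONEST DEPENDENCY (cell line): continuum YM on T⁴ ⇐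
BetaPertH ∧ nine spine estimates (0/9 proved); BetaPertH ⇐ (D1) ∧ (D4) ∧ CAP+tail; G-an2-4 gates asym, D1 and NE2/3/4.  NEW file; nothing modified.  Net new unproved
facts: 0.
-/

noncomputable section

open scoped BigOperators InnerProductSpace

namespace Literature.MathematicalPhysics.QuantumFieldTheory.Balaban1983to89.B9Eq342GradientRowPureGaugeUnweighted

open B4Sect5Torus (TSite)
open B9SectCLatticeCarrier (Bond bpos btgt shift unshift)
open B4TorusKernel.MultiPeriod (circAbs)
open B5Prop11Plancherel (Tor unitVec)
open B9Eq311L2Pairing (WL2)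
open B9Eq310HessianOperator (adTransportW)
open B11Eq103H1Complex (SiteL2K covLaplaceSiteK covDerivL2K greenK)
open B9Eq328GaugeAction (gaugeU AdW)
open B5Eq129FreeResolventGradientRow (norm_apply_sub_le_of_resolvent)
open B5Eq129FreeResolventGradientRowSites (gradRow_tsite_of_tor_shift)
open B9Eq331PureGaugeResolventConjugation (norm_covDeriv_pureGauge_le_of_flat)
open B9Eq331PureGaugeResolventLetters (rePos_covLaplaceSiteK_pureGauge_add pureGauge_resolvent_eq)
open B9Eq342GradientRowBootstrap (norm_le_of_gradient_response_bootstrap)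
open B9Eq342GradientRowComparisonMass (theta_lt_one_of_comparison_mass output_le_of_comparison_mass)

variable {d : ℕ} {N : Fin d → ℕ} [∀ μ, NeZero (N μ)] {𝔸 : Type*} [Ring 𝔸] [Algebra ℂ 𝔸] {W : Type*} [NormedAddCommGroup W] [InnerProductSpace ℂ W]
  (φ : W ≃ₗ[ℂ] 𝔸) {c₀ : ℝ} [Fact (0 < c₀)] (g : TSite d N → 𝔸ˣ)
  (hAd : ∀ (x : TSite d N) (v v' : W), ⟪AdW φ (g x) v, AdW φ (g x) v'⟫_ℂ = ⟪v, v'⟫_ℂ)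

include hAd in
/-- §1 **THE UNWEIGHTED COVARIANT GRADIENT ROW OF THE PURE-GAUGE RESOLVENT**: `t > 0`, `m > 0`; every solution of `Δ_{U⁰}u + m u = h` with `‖h(y)‖ ≤ F` obeys
`‖(∇_{U⁰}u)(b)‖ ≤ |t|·((2∕√(m² + 4mt²))·F)` — (K29) §4 with `Hflat :=` (K27) at `a = 0` ∘ (C) `norm_apply_sub_le_of_resolvent`. [folklore]
[cite: Balaban1985BackgroundPropagators, Thm 3.1 (3.42) p.397, p.398, (3.31) p.395; Balaban1984PropagatorsI, (1.29) p.23] -/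
theorem norm_covDeriv_pureGauge_le_unweighted (t : ℝ) (ht : 0 < t) {m : ℝ} (hm : 0 < m) {u h : SiteL2K ℂ d N c₀ W}
    (hu : covLaplaceSiteK (t : ℂ) (adTransportW φ (gaugeU g 1)) (adTransportW φ fun b => (gaugeU g 1 b)⁻¹) u + (m : ℂ) • u = h)
    {F : ℝ} (hh : ∀ y, ‖WL2.equiv ℂ _ W h y‖ ≤ F) (b : Bond d N) :
    ‖WL2.equiv ℂ _ W (covDerivL2K ℂ c₀ (t : ℂ) (adTransportW φ (gaugeU g 1)) u) b‖ ≤ ‖(t : ℂ)‖ * (2 / Real.sqrt (m ^ 2 + 4 * m * t ^ 2) * F) := by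
  classical
  -- any centre for the (trivial) weight
  have x₀ : TSite d N := bpos b
  have key := norm_covDeriv_pureGauge_le_of_flat φ g hAd
    (Ws := fun y => ∏ μ, Real.cosh (0 * (circAbs (N μ) ((((x₀ μ : ℕ) : ZMod (N μ)) - ((y μ : ℕ) : ZMod (N μ))).val) : ℝ)))
    (Bb := fun _ : Bond d N => 2 / Real.sqrt (m ^ 2 + 4 * m * t ^ 2)) (t := t) (m := m) (fun V K F' hV hK b' => by
      have h := gradRow_tsite_of_tor_shift N (t := t) (m := m) (a := 0) (B := fun _ => 2 / Real.sqrt (m ^ 2 + 4 * m * t ^ 2))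
        (fun u' g' c F'' hu' hg' ν x => by
          have hg'' : ∀ y, ‖g' y‖ ≤ F'' := fun y => by simpa [zero_mul, Real.cosh_zero] using hg' y
          have hC := norm_apply_sub_le_of_resolvent N t ht.ne' hm hu' hg'' (x - unitVec N ν) ν
          rw [sub_add_cancel, norm_sub_rev] at hC
          simpa [zero_mul, Real.cosh_zero] using hC)
        hV x₀ hK b'.2 b'.1
      simpa [zero_mul, Real.cosh_zero] using h) (t : ℂ) hu
    (F := F) (fun y => by simpa [zero_mul, Real.cosh_zero] using hh y) b
  simpa [zero_mul, Real.cosh_zero] using key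

section Closing

variable [FiniteDimensional ℂ W] (t m : ℝ) (hm : 0 < m)

/-- (local, syntactic) the resolvent map `R⁰ = greenK (Δ_{U⁰} + m·1) hpos`. -/
local notation "R⁰" => (greenK (covLaplaceSiteK (c₀ := c₀) ((t : ℝ) : ℂ) (adTransportW φ (gaugeU g 1)) (adTransportW φ fun b => (gaugeU g 1 b)⁻¹) +
    ((m : ℝ) : ℂ) • LinearMap.id : SiteL2K ℂ d N c₀ W →ₗ[ℂ] SiteL2K ℂ d N c₀ W) (rePos_covLaplaceSiteK_pureGauge_add φ g hAd t hm))

/-- §2 **THE UNWEIGHTED `hT`**: `T b h := (∇_{U⁰}(R⁰h̃))(b)` satisfies `0 ≤ F → (∀ y, ‖h y‖ ≤ F·1) → ‖T b h‖ ≤ (|t|·2∕√(m² + 4mt²))·F·1`. [folklore]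
[cite: Balaban1985BackgroundPropagators, Thm 3.1 (3.42) p.397, (3.23) p.394; Balaban1984PropagatorsI, (1.29) p.23] -/
theorem hT_unweighted (ht : 0 < t) (b : Bond d N) (h : TSite d N → W) (F : ℝ) (_hF : 0 ≤ F) (hh : ∀ y, ‖h y‖ ≤ F * (fun _ : TSite d N => (1 : ℝ)) y) :
    ‖WL2.equiv ℂ _ W (covDerivL2K ℂ c₀ (t : ℂ) (adTransportW φ (gaugeU g 1)) (R⁰ ((WL2.equiv ℂ (fun _ : TSite d N => c₀) W).symm h))) b‖ ≤
      (|t| * (2 / Real.sqrt (m ^ 2 + 4 * m * t ^ 2))) * F * (fun _ : Bond d N => (1 : ℝ)) b := by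
  have hh' : ∀ y, ‖WL2.equiv ℂ _ W ((WL2.equiv ℂ (fun _ : TSite d N => c₀) W).symm h) y‖ ≤ F := fun y => by
    rw [Equiv.apply_symm_apply]; simpa using hh y
  have h1 := norm_covDeriv_pureGauge_le_unweighted φ g hAd t ht hm (pureGauge_resolvent_eq φ g hAd t m hm _) hh' b
  rw [Complex.norm_real, Real.norm_eq_abs] at h1
  simpa [mul_assoc, mul_comm, mul_left_comm] using h1

/-- §3 **N44 §5 CHECKED — THE WINDOW-FREE CLOSING AT THE PURE GAUGE, UNWEIGHTED**: (GRB) §4 with `T b h := (∇_{U⁰}(R⁰h̃))(b)`, `w ≡ 1`, `w′ ≡ 1`,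
`S := |t|·2∕√(m² + 4mt²)`, `hθ` DISCHARGED by (K35) from `2ε₁ ≤ √m`; (REP)∕(DATA)∕(PERT) displayed weight-free ⊢ `‖D b‖ ≤ 2(Γ + ε₂N)∕√m + 2(ε₀N)` (t4-ne9-idea-1 g143 N44). [folklore]
[cite: Balaban1985BackgroundPropagators, Thm 3.1 (3.42) p.397, p.398] -/
theorem closing_unweighted (ht : 0 < t) (D : Bond d N → W) (gdat Vdat : Bond d N → TSite d N → W) {ε₀ ε₁ ε₂ Γ Nv : ℝ} (hε₁ : 0 ≤ ε₁) (hε₂ : 0 ≤ ε₂)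
    (hΓ : 0 ≤ Γ) (hNv : 0 ≤ Nv) (hε₀N : 0 ≤ ε₀ * Nv) (hmε : 2 * ε₁ ≤ Real.sqrt m)
    (hrep : ∀ b, ‖D b‖ ≤ ‖WL2.equiv ℂ _ W (covDerivL2K ℂ c₀ (t : ℂ) (adTransportW φ (gaugeU g 1))
        (R⁰ ((WL2.equiv ℂ (fun _ : TSite d N => c₀) W).symm fun y => gdat b y - Vdat b y))) b‖ + ε₀ * Nv)
    (hg : ∀ b y, ‖gdat b y‖ ≤ Γ) (hV : ∀ M : ℝ, 0 ≤ M → (∀ b, ‖D b‖ ≤ M) → ∀ b y, ‖Vdat b y‖ ≤ ε₁ * M + ε₂ * Nv) (b : Bond d N) :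
    ‖D b‖ ≤ 2 * (Γ + ε₂ * Nv) / Real.sqrt m + 2 * (ε₀ * Nv) := by
  have hGRB := norm_le_of_gradient_response_bootstrap D
    (fun b h => WL2.equiv ℂ _ W (covDerivL2K ℂ c₀ (t : ℂ) (adTransportW φ (gaugeU g 1)) (R⁰ ((WL2.equiv ℂ (fun _ : TSite d N => c₀) W).symm h))) b)
    gdat Vdat (fun _ => (1 : ℝ)) (fun _ => (1 : ℝ)) (fun _ => one_pos) hε₁ hε₂ hΓ hNv (theta_lt_one_of_comparison_mass t hm hε₁ hmε)
    (fun b => by rw [mul_one]; exact hrep b) (fun b h F hF hh => hT_unweighted φ g hAd t m hm ht b h F hF hh)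
    (fun b y => by rw [mul_one]; exact hg b y)
    (fun M hM hMb b y => by rw [mul_one]; exact hV M hM (fun b => by have := hMb b; rwa [mul_one] at this) b y)
  have hout := output_le_of_comparison_mass D (fun _ => (1 : ℝ)) (fun _ => one_pos) t hm hε₁ hε₂ hΓ hNv hε₀N hmε hGRB b
  rwa [mul_one] at hout

end Closing

/-! ## §4 A bond-dependent family of comparison gauges (the (REP) instance matches `U` to a pure gauge per cube of (3.35)) -/

section Family

variable [FiniteDimensional ℂ W] (gf : Bond d N → TSite d N → 𝔸ˣ)
  (hAdf : ∀ (b₀ : Bond d N) (x : TSite d N) (v v' : W), ⟪AdW φ (gf b₀ x) v, AdW φ (gf b₀ x) v'⟫_ℂ = ⟪v, v'⟫_ℂ) (t m : ℝ) (hm : 0 < m)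

/-- (local, syntactic) the resolvent map of the `b₀`-th comparison gauge `U⁰_{b₀} = 1^{g_{b₀}}`. -/
local notation "R⁰[" b₀ "]" => (greenK (covLaplaceSiteK (c₀ := c₀) ((t : ℝ) : ℂ) (adTransportW φ (gaugeU (gf b₀) 1)) (adTransportW φ fun b => (gaugeU (gf b₀) 1 b)⁻¹) +
    ((m : ℝ) : ℂ) • LinearMap.id : SiteL2K ℂ d N c₀ W →ₗ[ℂ] SiteL2K ℂ d N c₀ W) (rePos_covLaplaceSiteK_pureGauge_add φ (gf b₀) (hAdf b₀) t hm))

/-- §4 **THE WINDOW-FREE CLOSING AT A BOND-DEPENDENT FAMILY OF PURE GAUGES, UNWEIGHTED**: §3 with `T b₀ h := (∇_{U⁰_{b₀}}(R⁰_{b₀}h̃))(b₀)` for comparison gauges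
`g_{b₀}` (`hAd` each) — §2's letter is uniform in the gauge; (REP) now against the `b₀`-th gauge; `hθ` by (K35) from `2ε₁ ≤ √m` ⊢
`‖D b‖ ≤ 2(Γ + ε₂N)∕√m + 2(ε₀N)`. [folklore] [cite: Balaban1985BackgroundPropagators, Thm 3.1 (3.42) p.397, (3.35) p.396, p.398] -/
theorem closing_unweighted_family (ht : 0 < t) (D : Bond d N → W) (gdat Vdat : Bond d N → TSite d N → W) {ε₀ ε₁ ε₂ Γ Nv : ℝ} (hε₁ : 0 ≤ ε₁)
    (hε₂ : 0 ≤ ε₂) (hΓ : 0 ≤ Γ) (hNv : 0 ≤ Nv) (hε₀N : 0 ≤ ε₀ * Nv) (hmε : 2 * ε₁ ≤ Real.sqrt m)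
    (hrep : ∀ b₀, ‖D b₀‖ ≤ ‖WL2.equiv ℂ _ W (covDerivL2K ℂ c₀ (t : ℂ) (adTransportW φ (gaugeU (gf b₀) 1))
        (R⁰[b₀] ((WL2.equiv ℂ (fun _ : TSite d N => c₀) W).symm fun y => gdat b₀ y - Vdat b₀ y))) b₀‖ + ε₀ * Nv)
    (hg : ∀ b y, ‖gdat b y‖ ≤ Γ) (hV : ∀ M : ℝ, 0 ≤ M → (∀ b, ‖D b‖ ≤ M) → ∀ b y, ‖Vdat b y‖ ≤ ε₁ * M + ε₂ * Nv) (b : Bond d N) :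
    ‖D b‖ ≤ 2 * (Γ + ε₂ * Nv) / Real.sqrt m + 2 * (ε₀ * Nv) := by
  have hGRB := norm_le_of_gradient_response_bootstrap D
    (fun b₀ h => WL2.equiv ℂ _ W (covDerivL2K ℂ c₀ (t : ℂ) (adTransportW φ (gaugeU (gf b₀) 1))
      (R⁰[b₀] ((WL2.equiv ℂ (fun _ : TSite d N => c₀) W).symm h))) b₀)
    gdat Vdat (fun _ => (1 : ℝ)) (fun _ => (1 : ℝ)) (fun _ => one_pos) hε₁ hε₂ hΓ hNv (theta_lt_one_of_comparison_mass t hm hε₁ hmε)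
    (fun b => by rw [mul_one]; exact hrep b) (fun b₀ h F hF hh => hT_unweighted φ (gf b₀) (hAdf b₀) t m hm ht b₀ h F hF hh)
    (fun b y => by rw [mul_one]; exact hg b y)
    (fun M hM hMb b y => by rw [mul_one]; exact hV M hM (fun b => by have := hMb b; rwa [mul_one] at this) b y)
  have hout := output_le_of_comparison_mass D (fun _ => (1 : ℝ)) (fun _ => one_pos) t hm hε₁ hε₂ hΓ hNv hε₀N hmε hGRB b
  rwa [mul_one] at hout

end Family

end Literature.MathematicalPhysics.QuantumFieldTheory.Balaban1983to89.B9Eq342GradientRowPureGaugeUnweighted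

end
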